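import Summits.ABC.IUTFork.Repair.RHAxisCK1Requirements
import Summits.ABC.IUTFork.Repair.RHReqsideWeightLawsBedKappaThreeHalves
import HarnessLib

/-!
# R-H ROUND 4, R4-2 (KEY «R4REQ-TYPE»): the SPEC `SpecK1 a μ₀` a Θ-pilot / log-volume computation must meet, CELL BY CELL, to realise a live κ₁ door
# O-01…O-05 (weight law `κ′ = a/2 ∈ {1, 3/2}`, target kept fraction `μ₀`) — typed over the k1 family files, bed-witnessed at FREY `p = 7`, `l = 107`

abc-iut cell, rung LADDER-ABC:A2.RESCUE.H; seat abc-iut-reqb-typ-1 (GEN 9; KEY `wake/KEY-abc-iut-reqb-typ-1-R4REQ-TYPE.md` f0e4e57e017d76a0, abc-iut-rh-lead g5 13:46:57Z under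
director-abc g6-D5 and HUMAN D-0133 · D-0134 · D-0135); census `plan/rescue/R-H/ROUND4/OPENINGS-CENSUS.md` (live; rows O-01…O-05 = the five k1 P-points of AXIS-C, labels
CONSISTENT-BUT-UNMOTIVATED, status LIVE = untested openings, not results); task text `ROUND4/R4-TASKS.md` 12c6e693e3cee1dc row 6; referee rh-ref-1. SHEET-SIDE WORDING
(delivered BY NAME, used section by section): κ′ = 1 — abc-iut-rh3-gen-1 g8 `HOME/abc-iut-rh3-gen-1/g8/SPECK1-K1-WORDING.md` 6552cf391569b259 (O0–O9); κ′ = 3/2 —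
abc-iut-rh3-gen-2 g9 `HOME/abc-iut-rh3-gen-2/g9/SPECK1-K32-WORDING.md` 1e40de5381c256d5 (S0–S8). AXIS-C sheets of record: CFG-01 v2 b48b9637cf79f32d · CFG-02 v2
a08e20e4aa0aeaf4 · CFG-03 v2 20054eaad1a1d4d1 · CFG-04 v3 907a784ee77f333b · CFG-05 v3 12b49ec4d4802f84 (referee PASS 15/15, AXIS-C/INDEX.md b3f8c2fa94ba537c).

WHAT `SpecK1 a μ₀` SAYS (a SPEC = what a new construction must OUTPUT for the door's inequality to follow through the typed Cor 3.12-shape door of record — not a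
claim that one exists). At a datum (places `s`, place data `(e, m, δ, r_in, r_out)` = `(e_w, m_q, D_w, R_in,w, R_out,w)`, weights `u_w ≥ 0`, `L = l⋆` labels) a
computation OUTPUTS, cell by cell, a pilot ORDER `ord w j`, a DEMAND `dem w j` booked into the mass, and a licence verdict `licensed w j`; the spec demands:
(O1) `ord w j = lawPow a j · m_w` (`⌈j^{a/2}⌉·m_q`; print: `j²·m_q`); (O2) `dem w j = ord w j − m_w` — demand `(⌈j^{a/2}⌉ − 1)·m_q` and pilot order move TOGETHER
(REQB-SPEC §1 k1: «a setting that changes one and not the other is a k5 setting, not k1»); (O3) the licence test is print's exact U2 hull cell with the OUTPUT order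
in the floor argument and every margin / indeterminacy term AT PRINT (`j·δ_w`, `(j+1)·r_in,w`, `(j+1)·r_out,w`, floor by `e_w`: knob string «k2=print c=1 cD=1 pk=j+1
rnd=floor»); (O4 = O5 of the wording) the print label set `{1, …, l⋆}`, EACH CELL ONCE with uniform weight (the box `ω ≡ 1` of `RHToptKnapsackDual`; no truncation,
parity subset or multiplicity), the kept set read label-wise as the licence set (segment-closure is the OPTIONAL strengthening `SpecK1Segment`, both seats'
recommendation (ii)+(i)); (O5 = O6/S5) the target: the mass booked from `dem` is `M_a = reqMass (lawPow a) 1 l⋆ U` and the tier-L1 exact deficit of the output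
orders satisfies `DD_a(datum) ≤ (1 − μ₀)·M_a(datum)` (`datum_meets_iff` p522952). CALIBRATION (`specK1_iff`): with the CANONICAL outputs `ordOf a m`, `demOf a m` the
spec IS `AxisCK1Requirements.R1_licenceLaw a ∧ R1_meets a μ₀` (p534392) — so every landed per-row face applies BY NAME. DOORS: `SpecK1_O01` … `SpecK1_O05`
(`a = 2`: μ₀ = 27/64, ½, ¾; `a = 3`: μ₀ = 27/64, ½). WORKED, BED-WITNESSED INSTANCES (§3, FREY `p = 7`, `l = 107` place of record `e 1605, m 210, δ 1604, r_in 268,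
r_out −4472, l⋆ 53`): the numbers the spec demands there — orders `j·210` (κ′ = 1: 11,130 at `j = 53`) resp. `⌈j^{3/2}⌉·210` (κ′ = 3/2; print `j²·210 = 589,890` at
`j = 53`), EVERY label licensed (`worked_kappaOne_all` / `worked_kappaThreeHalves_all`, p506542), `DD = 0` (`worked_exactDeficit`), masses `1378·210 = 289,380` resp.
`8345·210 = 1,752,450` against print's `50986·210 = 10,707,060` (`worked_tierL1_words`), hence the spec HOLDS at the one-place worked datum for every `μ₀ ≤ 1`
(`worked_specK1_two`, `worked_specK1_three`) — contrast print: 31 labels IN / 32 OUT, `DD = 2,471,121` (`worked_print`, `worked_exactDeficit`).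
WHAT PRINT DOES NOT SUPPLY (the sheets' S-items ↔ `R4_thetaSection a` / `R5_cyclotomicRigidity a` / `R6_pilotDegreeLaw a`, located ≠ adjudicated): an evaluation
section with order law `⌈j^{a/2}⌉`; both wording files record (hand check, not kernel-checked here) that the full-`ℤ` factor-of-automorphy clause (ii′) of
`R4_valueLaw a` is unsatisfiable at the value level for `a ∈ {2, 3}` once `0 < ‖q̈‖ < 1` and a unit `U₀ ≠ ±1` exists — so the satisfiable value-level clause the spec's
(O1) consumes is the VALUE-PORTION law alone (`R4_valueLaw.norm_translate` shape); refuted-as-typed ≠ refuted-in-print. Downstream constants the doors carry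
(bookkeeping, by name): `u₁(l) = 2l(l+5)/(l−3)` (`R3_downstreamConstantKappaOne_holds`), `u_{3/2}(l) ≥ 2l/⌈√l⋆⌉` (`R3_downstreamConstant32_holds`) — unbounded in `l`.

HONEST FRAMING / GUARDS: every `def … : Prop` here is a claim-tagged HYPOTHESIS / SPEC in OUR typed cell currency, never a Literature fact (no new `Prop` fact; inputs ⊆
the frozen FACT-LIST f75a60bac22efdb6 + the landed modules imported above); a LIVE door is an untested opening, not a result; CONSISTENT-BUT-UNMOTIVATED = no print
locus supplies output (O1) and none contradicts (O1)–(O5) as typed; located ≠ adjudicated; typed ≠ proved; computed ≠ proved; nothing here asserts that abc is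
proved or refuted, or takes a side on [IUTchIII] Cor. 3.12 / Rmk 3.9.x / [IUTchIV] Thm. 1.10 or on any author (D-0045). [claim: Mochizuki2012, status: disputed]
[cite: Mochizuki2012, IUTchIII Cor. 3.12 p. 173–174, Rmk. 3.9.3 p. 119–120; IUTchIV Prop. 1.4 p. 13, Thm. 1.10 Step (v)–(viii) p. 27–29]
-/

noncomputable section
open Finset
namespace Summit.ABC.IUTFork.Repair.RH.AxisCK1Spec
open Summit.ABC.IUTFork.Repair.RH.ReqsideWeightLaws Summit.ABC.IUTFork.Repair.RH.AxisCK1Requirements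

/-! ## §1. The SPEC, parametric in the law exponent `a = 2κ′` and the target `μ₀` -/

section Spec

variable {ι : Type*}

/-- The CANONICAL pilot-order output of a κ′-computation at a place of depth `m_q`: `⌈j^{a/2}⌉·m_q` at label `j` (print: `j²·m_q`). Bookkeeping. [folklore] -/
def ordOf (a : ℕ) (mq : ℤ) (j : ℕ) : ℤ := lawPow a j * mq

/-- The CANONICAL demand booked into the mass: order minus the trivial `j`-cell mass `m_q`, i.e. `(⌈j^{a/2}⌉ − 1)·m_q` (print: `(j² − 1)·m_q`). Bookkeeping. [folklore] -/
def demOf (a : ℕ) (mq : ℤ) (j : ℕ) : ℤ := ordOf a mq j - mq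

/-- **`SpecK1 a μ₀` — THE REQUIREMENTS PROP of a κ₁ door** (R4-2; wording rh3-gen-1 O0–O6 / rh3-gen-2 S0–S5): at a datum (places `s`, place data `(e, m, δ, r_in, r_out)`,
weights `u`, `L = l⋆` labels) a Θ-pilot / log-volume computation with per-cell OUTPUTS `ord` (pilot order), `dem` (demand booked into the mass) and `licensed` (licence
verdict) REALISES the door `(κ′ = a/2, μ₀)` iff: (O1) `ord w j = ⌈j^{a/2}⌉·m_w` at every place and label; (O2) `dem w j = ord w j − m_w` — demand and pilot order move
TOGETHER; (O3) `licensed w j ↔ e_w·⌊(ord w j − (j·δ_w + (j+1)·r_in,w))/e_w⌋ ≤ m_w − (j+1)·r_out,w` — print's exact U2 hull cell with the output order and every margin term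
AT PRINT; (O4) the mass booked over the print label set `{1, …, L}`, each cell ONCE, with the place weights, IS `Σ_w Σ_{j ≤ L} dem w j · u_w`; (O5) the tier-L1 exact
deficit of the output orders (label-wise kept set; `datumDeficit (lawPow a)`, p522952) is at most `(1 − μ₀)` times that mass. A SPEC in OUR typed cell currency — what a
construction must OUTPUT, not a claim that one exists; CONSISTENT-BUT-UNMOTIVATED per the AXIS-C sheets CFG-01…05 (no print locus supplies (O1); located ≠ adjudicated).
[claim: Mochizuki2012, status: disputed] -/
@[claim "Mochizuki2012" "disputed"]
def SpecK1 (a : ℕ) (μ₀ : ℝ) (s : Finset ι) (e m δ rin rout : ι → ℤ) (u : ι → ℝ) (L : ℕ)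
    (ord dem : ι → ℕ → ℤ) (licensed : ι → ℕ → Prop) : Prop :=
  (∀ w ∈ s, ∀ j, 1 ≤ j → j ≤ L → ord w j = lawPow a j * m w) ∧
  (∀ w ∈ s, ∀ j, 1 ≤ j → j ≤ L → dem w j = ord w j - m w) ∧
  (∀ w ∈ s, ∀ j, 1 ≤ j → j ≤ L →
    (licensed w j ↔ e w * ((ord w j - ((j : ℤ) * δ w + ((j : ℤ) + 1) * rin w)) / e w) ≤ m w - ((j : ℤ) + 1) * rout w)) ∧
  (∑ w ∈ s, ∑ i ∈ range L, (dem w (i + 1) : ℝ) * u w) = reqMass (lawPow a) 1 L (∑ w ∈ s, (m w : ℝ) * u w) ∧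
  datumDeficit (lawPow a) 1 s e m δ rin rout u L ≤ (1 - μ₀) * reqMass (lawPow a) 1 L (∑ w ∈ s, (m w : ℝ) * u w)

/-- (O3) with the canonical order IS the k1-cell of the currency: `e·⌊(⌈j^{a/2}⌉·m − (jδ + (j+1)r_in))/e⌋ ≤ m − (j+1)·r_out` is `Cell (lawPow a) 1 e m δ rin rout j`
(p506542; `den = 1`). [folklore] -/
theorem cell_iff_ordOf (a : ℕ) (e m δ rin rout : ℤ) (j : ℕ) :
    Cell (lawPow a) 1 e m δ rin rout j ↔ e * ((ordOf a m j - ((j : ℤ) * δ + ((j : ℤ) + 1) * rin)) / e) ≤ m - ((j : ℤ) + 1) * rout := by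
  unfold Cell ordOf
  simp only [one_mul]

/-- (O4) with the canonical demand HOLDS: `Σ_w Σ_{j ≤ L} (⌈j^{a/2}⌉ − 1)·m_w·u_w = reqMass (lawPow a) 1 L (Σ_w m_w·u_w)` (`demandSum`, `reqMass`, p508156). [folklore] -/
theorem mass_demOf (a : ℕ) (s : Finset ι) (m : ι → ℤ) (u : ι → ℝ) (L : ℕ) :
    (∑ w ∈ s, ∑ i ∈ range L, (demOf a (m w) (i + 1) : ℝ) * u w) = reqMass (lawPow a) 1 L (∑ w ∈ s, (m w : ℝ) * u w) := by
  unfold reqMass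
  rw [Int.cast_one, div_one, Finset.mul_sum]
  refine Finset.sum_congr rfl fun w _ => ?_
  unfold demandSum demOf ordOf
  push_cast
  simp only [Finset.sum_mul]
  exact Finset.sum_congr rfl fun i _ => by ring

/-- **CALIBRATION**: with the CANONICAL outputs (`ordOf`, `demOf`) the spec IS the k1 family's licence law AND meets word — `R1_licenceLaw a ∧ R1_meets a μ₀` (p534392) —
so every landed per-row face (bed words, place-wise forms, ratio words) applies to `SpecK1` BY NAME. [folklore] -/
theorem specK1_iff (a : ℕ) (μ₀ : ℝ) (s : Finset ι) (e m δ rin rout : ι → ℤ) (u : ι → ℝ) (L : ℕ) (licensed : ι → ℕ → Prop) :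
    SpecK1 a μ₀ s e m δ rin rout u L (fun w => ordOf a (m w)) (fun w => demOf a (m w)) licensed ↔
      R1_licenceLaw a s e m δ rin rout L licensed ∧ R1_meets a μ₀ s e m δ rin rout u L := by
  unfold SpecK1 R1_licenceLaw R1_meets
  constructor
  · rintro ⟨-, -, h3, -, h5⟩
    refine ⟨fun w hw j hj hjL => ?_, h5⟩
    rw [h3 w hw j hj hjL, cell_iff_ordOf]
  · rintro ⟨h1, h5⟩
    refine ⟨fun w _ j _ _ => rfl, fun w _ j _ _ => rfl, fun w hw j hj hjL => ?_, mass_demOf a s m u L, h5⟩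
    rw [h1 w hw j hj hjL, cell_iff_ordOf]

/-- Conversely ANY outputs meeting the spec are the canonical ones on the labels `1 … L` (O1/O2 pin them), and the licence verdicts are the k1-cells. [folklore] -/
theorem specK1_outputs {a : ℕ} {μ₀ : ℝ} {s : Finset ι} {e m δ rin rout : ι → ℤ} {u : ι → ℝ} {L : ℕ} {ord dem : ι → ℕ → ℤ}
    {licensed : ι → ℕ → Prop} (h : SpecK1 a μ₀ s e m δ rin rout u L ord dem licensed) {w : ι} (hw : w ∈ s) {j : ℕ} (hj : 1 ≤ j) (hjL : j ≤ L) :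
    ord w j = ordOf a (m w) j ∧ dem w j = demOf a (m w) j ∧ (licensed w j ↔ Cell (lawPow a) 1 (e w) (m w) (δ w) (rin w) (rout w) j) := by
  obtain ⟨h1, h2, h3, -, -⟩ := h
  refine ⟨h1 w hw j hj hjL, by rw [demOf, ordOf, h2 w hw j hj hjL, h1 w hw j hj hjL], ?_⟩
  rw [h3 w hw j hj hjL, cell_iff_ordOf, ordOf, h1 w hw j hj hjL]

/-- Hence ANY realisation of the spec delivers the k1 family's licence law and MEETS word (the door's inequality in the typed currency). [folklore] -/
theorem specK1_requirements {a : ℕ} {μ₀ : ℝ} {s : Finset ι} {e m δ rin rout : ι → ℤ} {u : ι → ℝ} {L : ℕ} {ord dem : ι → ℕ → ℤ}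
    {licensed : ι → ℕ → Prop} (h : SpecK1 a μ₀ s e m δ rin rout u L ord dem licensed) :
    R1_licenceLaw a s e m δ rin rout L licensed ∧ R1_meets a μ₀ s e m δ rin rout u L :=
  ⟨fun _ hw _ hj hjL => (specK1_outputs h hw hj hjL).2.2, h.2.2.2.2⟩

/-- **OPTIONAL STRENGTHENING `SpecK1Segment`** (both seats' recommendation (i)): the licence set is an initial SEGMENT at every place (`R6_segmentClosedAt a`, p534392) —
what print's evaluation and [IUTchIV] Step (viii) use; NOT a theorem of the cell at `a ∈ {2, 3}` (`R6_segmentClosedAt_two_not_forall` / `_three_not_forall`, witnesses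
`kappaOne_not_downward_closed` / `kappaThreeHalves_not_downward_closed`, p524026); on the bed it happens to hold (κ′ = 1: 1,530 full segments + `{1, 2}` at the exception
place, `bed_kappaOne_all` / `bed_kappaOne_exception`; κ′ = 3/2: 1,483 saturating places, `bed_kappaThreeHalves_all`); implied trivially wherever a realisation licenses EVERY label
(`AxisCK1Requirements.LicenceAllLabels a`, `R6_segmentClosedAt_of_licenceAllLabels`, p536146). HYPOTHESIS. [claim: Mochizuki2012, status: disputed] -/
@[claim "Mochizuki2012" "disputed"]
def SpecK1Segment (a : ℕ) (s : Finset ι) (e m δ rin rout : ι → ℤ) (L : ℕ) : Prop :=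
  ∀ w ∈ s, R6_segmentClosedAt a (e w) (m w) (δ w) (rin w) (rout w) L

end Spec

/-! ## §2. The five live κ₁ doors O-01 … O-05 (OPENINGS-CENSUS rows; AXIS-C CFG-01 … CFG-05) -/

section Doors

variable {ι : Type*}

/-- **Door O-01** (κ′ = 1, μ₀ = 27/64; AXIS-C CFG-01 `P-k1kappa1-k5mu27/64`, sheet v2 b48b9637cf79f32d; bed words MEETS 133/133 · 79/79, ρ_min 2.2971 · 2.3704, μ_L1,min
0.9691 · 1.0000 — REQB-TABLE v1 b8ac679ede5d795b; faces `bed_kappaOne_all` p508362, `exception_datum_words_L0`.1 / `_L1`.1 p512285): `SpecK1 2 (27/64)`. Residual R-01b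
of the census = this Prop realised by SOME typed object. SPEC, not a claim. [claim: Mochizuki2012, status: disputed] -/
@[claim "Mochizuki2012" "disputed"]
def SpecK1_O01 (s : Finset ι) (e m δ rin rout : ι → ℤ) (u : ι → ℝ) (L : ℕ) (ord dem : ι → ℕ → ℤ) (licensed : ι → ℕ → Prop) : Prop :=
  SpecK1 2 (27 / 64) s e m δ rin rout u L ord dem licensed

/-- **Door O-02** (κ′ = 1, μ₀ = ½; CFG-02, sheet v2 a08e20e4aa0aeaf4; MEETS · MEETS, ρ_min 1.9382 · 2.0000, ρ(½) = 2·μ_L1; faces as O-01 with `…_L0`.2.1 / `…_L1`.2.1):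
`SpecK1 2 (1/2)`. Residual R-02b. SPEC, not a claim. [claim: Mochizuki2012, status: disputed] -/
@[claim "Mochizuki2012" "disputed"]
def SpecK1_O02 (s : Finset ι) (e m δ rin rout : ι → ℤ) (u : ι → ℝ) (L : ℕ) (ord dem : ι → ℕ → ℤ) (licensed : ι → ℕ → Prop) : Prop :=
  SpecK1 2 (1 / 2) s e m δ rin rout u L ord dem licensed

/-- **Door O-03** (κ′ = 1, μ₀ = ¾; CFG-03, sheet v2 20054eaad1a1d4d1; MEETS · MEETS as a TIER-L1 word — at the exception datum `…134881:7` NOT met at tier L0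
(`exception_datum_words_L0`.2.2.1: 132/133), met at L1 (`…_L1`.2.2.1); ρ_min 1.2921 · 1.3333 — the thinnest κ′ = 1 margin, the census's FIRST R4-1 target): `SpecK1 2 (3/4)`
(the spec states tier L1 = `datumDeficit`). Residual R-03b. SPEC, not a claim. [claim: Mochizuki2012, status: disputed] -/
@[claim "Mochizuki2012" "disputed"]
def SpecK1_O03 (s : Finset ι) (e m δ rin rout : ι → ℤ) (u : ι → ℝ) (L : ℕ) (ord dem : ι → ℕ → ℤ) (licensed : ι → ℕ → Prop) : Prop :=
  SpecK1 2 (3 / 4) s e m δ rin rout u L ord dem licensed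

/-- **Door O-04** (κ′ = 3/2, μ₀ = 27/64; CFG-04, sheet v3 907a784ee77f333b; MEETS · MEETS, ρ_min 1.7615 · 2.2366 — the κ′ = 3/2 law ALONE is PARTIAL 101/133 · 75/79, the
target carries the word; place-wise form `placewise_twentySevenSixtyFourths_iff` `64·DD_w ≤ 37·MM_w`, face `pairPK32M2764_datum_of_places` p515841): `SpecK1 3 (27/64)`.
Residual R-04b. SPEC, not a claim. [claim: Mochizuki2012, status: disputed] -/
@[claim "Mochizuki2012" "disputed"]
def SpecK1_O04 (s : Finset ι) (e m δ rin rout : ι → ℤ) (u : ι → ℝ) (L : ℕ) (ord dem : ι → ℕ → ℤ) (licensed : ι → ℕ → Prop) : Prop :=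
  SpecK1 3 (27 / 64) s e m δ rin rout u L ord dem licensed

/-- **Door O-05** (κ′ = 3/2, μ₀ = ½; CFG-05, sheet v3 12b49ec4d4802f84; MEETS · MEETS, ρ_min 1.4862 · 1.8871; place-wise `2·DD_w ≤ MM_w` `placewise_half_iff`, face
`ReqsidePairPK32M12.datum_of_places` p522096; `λ(½, 107) = 482` `lambdaLink_half_107`): `SpecK1 3 (1/2)`. Residual R-05b. SPEC, not a claim. [claim: Mochizuki2012, status: disputed] -/
@[claim "Mochizuki2012" "disputed"]
def SpecK1_O05 (s : Finset ι) (e m δ rin rout : ι → ℤ) (u : ι → ℝ) (L : ℕ) (ord dem : ι → ℕ → ℤ) (licensed : ι → ℕ → Prop) : Prop :=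
  SpecK1 3 (1 / 2) s e m δ rin rout u L ord dem licensed

/-- TARGET MONOTONICITY across the doors of one law (`R1_meets_anti`, p534392): a realisation of `SpecK1 a μ₀` realises `SpecK1 a μ₀′` for `μ₀′ ≤ μ₀` when `M_a ≥ 0` —
O-03 ⟹ O-02 ⟹ O-01 and O-05 ⟹ O-04, datum by datum, with the SAME outputs. [folklore] -/
theorem specK1_anti {a : ℕ} {μ₀ μ₀' : ℝ} (hμ : μ₀' ≤ μ₀) {s : Finset ι} {e m δ rin rout : ι → ℤ} {u : ι → ℝ} {L : ℕ} {ord dem : ι → ℕ → ℤ}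
    {licensed : ι → ℕ → Prop} (hM : 0 ≤ reqMass (lawPow a) 1 L (∑ w ∈ s, (m w : ℝ) * u w))
    (h : SpecK1 a μ₀ s e m δ rin rout u L ord dem licensed) : SpecK1 a μ₀' s e m δ rin rout u L ord dem licensed :=
  ⟨h.1, h.2.1, h.2.2.1, h.2.2.2.1, R1_meets_anti hμ hM h.2.2.2.2⟩

end Doors

/-! ## §3. WORKED, bed-witnessed instances at the FREY `p = 7`, `l = 107` place of record (`e 1605, m 210, δ 1604, r_in 268, r_out −4472`, `l⋆ = 53`) -/

section Worked

/-- The κ′-demand total is non-negative at every law exponent (`one_le_lawPow`: `⌈j^{a/2}⌉ ≥ 1` on labels `≥ 1`). [folklore] -/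
theorem demandSum_lawPow_nonneg (a n : ℕ) : 0 ≤ demandSum (lawPow a) 1 n := by
  unfold demandSum
  exact Finset.sum_nonneg fun i _ => by linarith [one_le_lawPow a (show 1 ≤ i + 1 by omega)]

/-- The worked place as a ONE-PLACE datum (index type `Unit`): place data and the label count `l⋆ = 53`. Bookkeeping. [folklore] -/
def workedS : Finset Unit := {()}

/-- **κ′ = 1 — THE NUMBERS THE SPEC DEMANDS AT THE WORKED PLACE** (wording O7): orders `j·210` — `210, 420, 630, …, 11,130` at `j = 53` (print `j²·210`: `589,890` at
`j = 53`); demands `(j − 1)·210` — `10,920` at `j = 53` (print `589,680`); demand total `Σ_{j ≤ 53}(j − 1) = 1378`, place mass `1378·210 = 289,380` (print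
`50986·210 = 10,707,060`, ratio `3/111`). Kernel numerals (`lawPow_two`, `two_mul_demandSum_id`). [folklore] -/
theorem worked_numbers_two :
    ordOf 2 210 1 = 210 ∧ ordOf 2 210 2 = 420 ∧ ordOf 2 210 53 = 11130 ∧ demOf 2 210 53 = 10920 ∧ (53 : ℤ) ^ 2 * 210 = 589890 ∧
      demandSum (lawPow 2) 1 53 = 1378 ∧ 210 * demandSum (lawPow 2) 1 53 = 289380 := by
  have hD : demandSum (lawPow 2) 1 53 = 1378 := by
    have h := two_mul_demandSum_id 53
    have hc : demandSum (lawPow 2) 1 53 = demandSum (fun j => (j : ℤ)) 1 53 := by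
      unfold demandSum; exact Finset.sum_congr rfl fun i _ => by rw [lawPow_two]
    rw [hc]; push_cast at h; linarith
  refine ⟨?_, ?_, ?_, ?_, by norm_num, hD, by rw [hD]; norm_num⟩ <;> simp only [ordOf, demOf, lawPow_two] <;> norm_num

/-- **κ′ = 1 — THE SPEC HOLDS AT THE WORKED ONE-PLACE DATUM for every `μ₀ ≤ 1`** (so at all three doors O-01/02/03), with the canonical outputs and EVERY label
licensed: all 53 labels are κ = 1 cells (`worked_kappaOne_all`, p506542: `m = 210 ≤ δ + (r_in − r_out) = 6344`), the exact deficit is `0` (`worked_exactDeficit`.2.1), so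
`DD(datum) = 0 ≤ (1 − μ₀)·M₁` for any weight `u ≥ 0`. Contrast print at the same place: label 31 IN, 32 OUT, `DD = 2,471,121` (`worked_print`, `worked_exactDeficit`.1).
[folklore] -/
theorem worked_specK1_two {μ₀ u : ℝ} (hμ : μ₀ ≤ 1) (hu : 0 ≤ u) :
    SpecK1 2 μ₀ workedS (fun _ => 1605) (fun _ => 210) (fun _ => 1604) (fun _ => 268) (fun _ => -4472) (fun _ => u) 53
      (fun _ => ordOf 2 210) (fun _ => demOf 2 210) (fun _ _ => True) := by
  rw [specK1_iff]
  refine ⟨fun w _ j hj _ => ⟨fun _ => ?_, fun _ => trivial⟩, ?_⟩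
  · exact (cell_congr (lawPow_two j) 1 1605 210 1604 268 (-4472)).2 (worked_kappaOne_all hj)
  · unfold R1_meets datumDeficit workedS
    have hDD : exactDeficit (lawPow 2) 1 1605 210 1604 268 (-4472) 53 = 0 := by
      rw [← worked_exactDeficit.2.1]
      unfold exactDeficit margin
      exact Finset.sum_congr rfl fun i _ => by rw [lawPow_two]
    simp only [Finset.sum_singleton, hDD, Int.cast_zero, zero_mul]
    refine mul_nonneg (by linarith) ?_
    unfold reqMass
    have hD : (0 : ℝ) ≤ ((demandSum (lawPow 2) 1 53 : ℤ) : ℝ) := by exact_mod_cast demandSum_lawPow_nonneg 2 53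
    rw [Int.cast_one, div_one]
    exact mul_nonneg hD (mul_nonneg (by norm_num) hu)

/-- **κ′ = 3/2 — THE NUMBERS THE SPEC DEMANDS AT THE WORKED PLACE** (wording S6): orders `⌈j^{3/2}⌉·210` — `210, 630, 1260, 1680, 2520` at `j = 1 … 5` (`lawPow_three_table`
p513467: `⌈j^{3/2}⌉ = 1, 3, 6, 8, 12`); demand total `Σ_{j ≤ 53}(⌈j^{3/2}⌉ − 1)` bracketed IN THE KERNEL by `1378 ≤ · ≤ 11395` (below: the κ′ = 1 total by
`lawPow_mono_exp`; above: `two_mul_demandSum_lawPow_three_le` with `⌈√53⌉ = 8`), the sheet's script value `8345` (place mass `8345·210 = 1,752,450`, ratio `0.1637` to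
print's `10,707,060`) lying inside — script ≠ kernel numeral. [folklore] -/
theorem worked_numbers_three :
    ordOf 3 210 1 = 210 ∧ ordOf 3 210 2 = 630 ∧ ordOf 3 210 3 = 1260 ∧ ordOf 3 210 4 = 1680 ∧ ordOf 3 210 5 = 2520 ∧
      1378 ≤ demandSum (lawPow 3) 1 53 ∧ demandSum (lawPow 3) 1 53 ≤ 11395 := by
  refine ⟨?_, ?_, ?_, ?_, ?_, ?_, ?_⟩
  · unfold ordOf; rw [lawPow_three_table 1 (by norm_num)]; norm_num
  · unfold ordOf; rw [lawPow_three_table 2 (by norm_num)]; norm_num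
  · unfold ordOf; rw [lawPow_three_table 3 (by norm_num)]; norm_num
  · unfold ordOf; rw [lawPow_three_table 4 (by norm_num)]; norm_num
  · unfold ordOf; rw [lawPow_three_table 5 (by norm_num)]; norm_num
  · rw [← worked_numbers_two.2.2.2.2.2.1]
    exact demandSum_mono (fun j hj => lawPow_mono_exp hj (by norm_num)) 1 53
  · have h := two_mul_demandSum_lawPow_three_le 53
    have h8 : (ceilSqrt 53 : ℤ) ≤ 8 := by exact_mod_cast ceilSqrt_le_of_le_sq (show 53 ≤ 8 ^ 2 by norm_num)
    push_cast at h
    nlinarith [h, h8]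

/-- **κ′ = 3/2 — THE SPEC HOLDS AT THE WORKED ONE-PLACE DATUM for every `μ₀ ≤ 1`** (so at both doors O-04/O-05): all 53 labels licensed
(`worked_kappaThreeHalves_all`, p506542: `8·210 = 1680 ≤ 6344`), exact deficit `0` (`worked_exactDeficit`.2.2.1), `DD(datum) = 0 ≤ (1 − μ₀)·M_{3/2}`; the per-row faces of
record at this place are `ReqsidePairPK32M12.worked_face` (μ₀ = ½, p522096) and `pairPK32M2764_worked_word` (μ₀ = 27/64, p515841), by name. [folklore] -/
theorem worked_specK1_three {μ₀ u : ℝ} (hμ : μ₀ ≤ 1) (hu : 0 ≤ u) :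
    SpecK1 3 μ₀ workedS (fun _ => 1605) (fun _ => 210) (fun _ => 1604) (fun _ => 268) (fun _ => -4472) (fun _ => u) 53
      (fun _ => ordOf 3 210) (fun _ => demOf 3 210) (fun _ j => j ≤ 53) := by
  rw [specK1_iff]
  refine ⟨fun w _ j hj hjL => ⟨fun _ => worked_kappaThreeHalves_all hj hjL, fun _ => hjL⟩, ?_⟩
  unfold R1_meets datumDeficit workedS
  simp only [Finset.sum_singleton, worked_exactDeficit.2.2.1, Int.cast_zero, zero_mul]
  refine mul_nonneg (by linarith) ?_
  unfold reqMass
  have hD : (0 : ℝ) ≤ ((demandSum (lawPow 3) 1 53 : ℤ) : ℝ) := by exact_mod_cast demandSum_lawPow_nonneg 3 53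
  rw [Int.cast_one, div_one]
  exact mul_nonneg hD (mul_nonneg (by norm_num) hu)

end Worked

end Summit.ABC.IUTFork.Repair.RH.AxisCK1Spec

end
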